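import Summits.RiemannHypothesis.RiemannHypothesis.Theses.RobinFullPortrait
import Summits.RiemannHypothesis.RiemannHypothesis.Theorems.RobinFullPortraitSuperabundant
import HarnessLib

/-!
# `RobinFullPortrait` — the Alaoglu–Erdős sharpening of the rung portrait (route lead g2 node)

Route `RobinFullPortrait` (RECORD class, column ROBIN; CLOSED·proved as the rung ROBIN-FULL-PORTRAIT,
`portrait_proof`, 2026-08-30) states: under Büthe 2018 (Thm 2), Broadbent–Kadiri–Lumley–Ng–Wilk 2021 (§1.2)
and `RiemannHypothesisUpTo 1.82·10¹⁰`, a least Robin violator `N > 5040` is superabundant, `2^26 ∣ N`, and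
`log N > 0.99947·(10¹⁹ − 1)`.  The middle conjunct was bought with the `t = 26` Solé–Planat leg
(`AnalyticLegTwentySix`, Mertens-remainder numerics at `x₀ = 2^61 − 1`).

With the RH-free, print-free Alaoglu–Erdős lemmas of `Theorems/RobinFullPortraitSuperabundant.lean`
(`two_pow_56_dvd`, `exists_large_prime_factor`, `dvd_of_prime_lt`) this file records (all CONDITIONAL on the
same three hypotheses as `Portrait`, in hypothesis position, NOT discharged):
* `portrait_sharp` — the sharpened portrait: SA, `2^56 ∣ N`, `log N > 0.99947·(10¹⁹−1)`, `P(N) > 10¹⁷`,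
  every prime `≤ 10¹⁷` divides `N`, and with any prime factor `N` contains every smaller prime.  Its proof
  touches NEITHER `AnalyticLegTwentySix` NOR `RangeLeg` (no other Theorems file of the route is imported):
  staircase (`RobinFiniteC1`, exactly as in `assembly_proof`) + Akbary–Friggstad Thm 3 + Alaoglu–Erdős.
* since `2^26 ∣ 2^56`, the CLOSED target `Portrait` follows from `portrait_sharp` WITHOUT the t-free machinery
  (not restated — dedup; cite `portrait_proof`).  So buying `t ≥ 27` θ-prints would add NOTHING to the
  portrait; t-free records matter only as density statements about all t-free `n` (route-file docstring,
  ceiling note `2⁻²⁷ < K ≈ 1.0·10⁻⁸`).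
* `portraitResidual_iff` — the route's declared residual `PortraitResidual` (aside·moot, RH-strength by design)
  is equivalent to its `2^26`-free form: the divisibility clause carries no information.

Nothing here bears on the truth of RH: these are structure statements about a hypothetical least violator.
A rung is not RH; RH is NOT proved by this file or this route.
Sources: [AlaogluErdos1944, §2 Thms 1–3, 7; doi:10.1090/s0002-9947-1944-0011087-2],
[arXiv:1211.2147, Thm 4.4, Prop 4.15], [AkbaryFriggstad2009, Thm 3].
Route lead rlead-rh-RobinFullPortrait g2 (D-0172/D-0179) filing; supports item stmt-RiemannHypothesis-24269.
-/

set_option linter.dupNamespace false  -- the mandated namespace repeats `RiemannHypothesis`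

namespace Summit.RiemannHypothesis.RiemannHypothesis.Theorems.RobinFullPortrait

open Real
open Literature.NumberTheory.LFunctions Literature.NumberTheory.DiophantineGeometry
open Summit.RiemannHypothesis.RiemannHypothesis.Theorems.Splittings

/-! ## §4 Consequences for the route `RobinFullPortrait` -/

/-- **The sharpened portrait of a least Robin violator** (CONDITIONAL on the route's three hypotheses, in
hypothesis position, NOT discharged): under Büthe 2018 Thm 2, BKLNW 2021 §1.2 and `RH up to height
1.82·10¹⁰`, a least `N > 5040` violating Robin's inequality is superabundant, `2^56 ∣ N`,
`log N > 0.99947·(10¹⁹ − 1)`, its largest prime factor exceeds `10¹⁷`, every prime `≤ 10¹⁷` divides `N`, and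
together with any prime factor `N` contains every smaller prime.  Structure of a hypothetical object; a
rung is not RH; RH is NOT proved.
[cite: AkbaryFriggstad2009, Thm 3; AlaogluErdos1944, §2 Thms 1–3, 7; arXiv:1211.2147, Thm 4.4, Prop 4.15] -/
theorem portrait_sharp :
    Buthe2018_thm2_theta → BroadbentEtAl2021_theta_rel_1e19 → RiemannHypothesisUpTo 18200000000 →
    ∀ N : ℕ, IsLeast {n : ℕ | 5040 < n ∧ ¬ robinInequality n} N →
      Nat.Superabundant N ∧ 2 ^ 56 ∣ N ∧ 0.99947 * ((10 : ℝ) ^ 19 - 1) < Real.log N ∧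
      (∃ P : ℕ, P.Prime ∧ P ∣ N ∧ 10 ^ 17 < P ∧ ∀ q ∈ N.primeFactors, q ≤ P) ∧
      (∀ q : ℕ, q.Prime → q ≤ 10 ^ 17 → q ∣ N) ∧
      (∀ p q : ℕ, p.Prime → p ∣ N → q.Prime → q < p → q ∣ N) := by
  intro hB hK hRH N hN
  have hSA : Nat.Superabundant N := AkbaryFriggstad2009_thm3 hN
  obtain ⟨⟨h5040, hfail⟩, _hmin⟩ := hN
  -- the size clause, from the staircase `RobinFiniteC1` exactly as in `assembly_proof` (t-free leg not used)
  have hlog : 0.99947 * ((10 : ℝ) ^ 19 - 1) < Real.log N := by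
    by_contra hle
    push Not at hle
    have hTop : robinCA_below (10 ^ 19 + 1) :=
      RobinFiniteC1.robinCA_below_high_18200000000 hB hK le_rfl hRH
    refine hfail (RobinFiniteC1.robin_all_of_robinCA_below_low hB hK hTop (by norm_num) N h5040 ?_)
    have e : (((10 ^ 19 : ℕ) : ℝ) - 1) = (10 : ℝ) ^ 19 - 1 := by push_cast; ring
    rw [e]; exact hle
  exact ⟨hSA, two_pow_56_dvd hSA hlog, hlog, exists_large_prime_factor hSA hlog,
    fun q hq hq17 => prime_dvd_of_le_ten_pow_17 hSA hlog hq hq17,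
    fun p q hp hpn hq hqp => dvd_of_prime_lt hSA hp hpn hq hqp⟩

/- `Portrait` itself (item stmt-RiemannHypothesis-24269, tree proof `portrait_proof` via the `t = 26` leg) follows from
`portrait_sharp` by `pow_dvd_pow 2 (by norm_num : 26 ≤ 56)` — i.e. WITHOUT the t-free leg or `RangeLeg`; it is not
restated here (the gate's dedup rule: one landed theorem per statement) — cite `portrait_proof` for the item. -/

/-- The route's declared residual `PortraitResidual` (aside·moot; RH-strength by design — Robin's inequality on
the portrayed class) is equivalent to its `2^26`-free form: by `two_pow_56_dvd` the divisibility clause is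
automatic for superabundant `N` of that size, so it carries no information.  (Bookkeeping only; neither side
is claimed; RH-strength either way.) [cite: AlaogluErdos1944, §2 Thm 1] -/
theorem portraitResidual_iff :
    Summit.RiemannHypothesis.RiemannHypothesis.Theses.RobinFullPortrait.PortraitResidual ↔
    ∀ N : ℕ, 5040 < N → Nat.Superabundant N → 0.99947 * ((10 : ℝ) ^ 19 - 1) < Real.log N →
      robinInequality N :=
  ⟨fun h N h1 h2 h3 => h N h1 h2 (dvd_trans (pow_dvd_pow 2 (by norm_num : 26 ≤ 56)) (two_pow_56_dvd h2 h3)) h3,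
    fun h N h1 h2 _ h3 => h N h1 h2 h3⟩

end Summit.RiemannHypothesis.RiemannHypothesis.Theorems.RobinFullPortrait
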